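import Summits.AtomisticToContinuum.FouriersLaw.Theses.OddSectorIrreversibility
import Summits.AtomisticToContinuum.FouriersLaw.Theses.BoundaryEscapeDeficit
import Summits.AtomisticToContinuum.FouriersLaw.Theorems.JunctionLocalitySuperadditiveResistanceStubLinearResponsePlain
import Summits.AtomisticToContinuum.FouriersLaw.Theorems.EmbeddedDrudeMourreNessUnique
import Summits.AtomisticToContinuum.FouriersLaw.Theorems.OddSectorIrreversibilityBoundedResponseConvergesStubPositiveConductance
import Summits.AtomisticToContinuum.FouriersLaw.Theorems.BoundedResponseConverges.Negative.TwoScaleKillCriteria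
import Literature.MathematicalPhysics.KineticTheory.LangevinChainNESSHolds

/-!
# `BoundedResponseConverges` (crux stmt-AtomisticToContinuum-9141) in ESCAPE-DEFICIT FORM

Helper file (`--supports stmt-AtomisticToContinuum-9141`, line `two-scale-gluing-log-rigidity`, lead seat c1) recording
what the crux IS once the fixed-`N` identities of 2026-08-16 are in the tree (`nessUnique_proof`,
`responseIdentity_proof : BoundaryEscapeDeficit.ResponseIdentity`, `positiveConductance_holds`): a statement about ONE
explicit real sequence per parameter point and temperature, built from EQUILIBRIUM objects only — the Gibbs measure
`μ_T = gibbsMeasure N T` and the equal-temperature kernels `P_t = transitionKernel N T T t` —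

  `e_N := (N - 1) · γ · E_N`,  `E_N = 1 - (γ/T²) ∫_{(0,∞)} K_N`,  `K_N(u) = ∫ (p₀² - T) · P_u(p₀² - T) dμ_T`

(the escape deficit of route `BoundaryEscapeDeficit`, verbatim its `let K`, `let E`). No NESS, no steady-state family,
no uniqueness hypothesis, no `δ → 0` limit survives:

* `boundedResponseConverges_iff_escapeDeficit` — **crux ⟺ (for all parameters `> 0` and `T > 0`: if `(|e_N|)_N` is
  bounded then `e_N → k` for some `k > 0`)**. (`→`: run the crux along the canonical steady-state family with
  `D N = e_N` (`N ≥ 1`), `D 0 = 0`; `←`: under the crux's own uniqueness hypothesis every response coefficient IS `e_N`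
  for `N ≥ 1`, by `responseIdentity_proof` and uniqueness of limits along `𝓝[≠] 0`.)
* `boundedResponseConverges_of_escapeLaw` — **`BoundaryEscapeDeficit.EscapeLaw → BoundedResponseConverges`**: the
  TARGET of route `BoundaryEscapeDeficit` (stmt-AtomisticToContinuum-12234, `e_N → κ_b > 0`) closes this crux outright
  (the crux's `BddAbove` is not even used).
* `boundedResponseConverges_of_escapeLadder` — **the equilibrium LADDER closes the crux**: if for all parameters and
  `T > 0` the sequence `e_N` is eventually non-decreasing (`(N-1)·E_N ≤ N·E_{N+1}` for `N ≥ N₀`; = the ladder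
  `D_N ≤ D_{N+1}` of line `ohmic-floor-monotone-ladder` / `KernelLadderUp` in auto-kernel form), then
  `BoundedResponseConverges` — boundedness is the crux's hypothesis, positivity of the limit is `D_N > 0` (`N ≥ 2`,
  `positiveConductance_holds`, p96209) fed into the landed kill criterion `boundedResponseConverges_ladder_matrix_iff`.

So after this morning's landings the crux's ENTIRE content is the large-`N` behaviour of `(N-1)·E_N` (convergence and
no insulation), i.e. exactly items `EscapeNonOscillation` (12238) + the Ohmic floor, or `EscapeLaw` (12234), or the
ladder; nothing fixed-`N` is left in it. No definitions, no named facts; standard axioms.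
-/

noncomputable section

open MeasureTheory Filter Topology Set

namespace Summit.AtomisticToContinuum.FouriersLaw.Theorems

open Literature.MathematicalPhysics.KineticTheory.HeatConduction
open Summit.AtomisticToContinuum.FouriersLaw.Theses

/-- Transfer of `BddAbove (range |·|)` along an equality off `N = 0`. [folklore] -/
theorem bddAbove_range_abs_of_eq_of_pos {a b : ℕ → ℝ} (hab : ∀ N : ℕ, 0 < N → a N = b N)
    (ha : BddAbove (Set.range fun N => |a N|)) : BddAbove (Set.range fun N => |b N|) := by
  obtain ⟨B, hB⟩ := ha
  refine ⟨max B |b 0|, ?_⟩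
  rintro _ ⟨N, rfl⟩
  show |b N| ≤ max B |b 0|
  rcases Nat.eq_zero_or_pos N with rfl | hN
  · exact le_max_right _ _
  · rw [← hab N hN]
    exact (hB ⟨N, rfl⟩).trans (le_max_left _ _)

/-- Transfer of a limit along an equality off `N = 0`. [folklore] -/
theorem tendsto_of_eq_of_pos {a b : ℕ → ℝ} (hab : ∀ N : ℕ, 0 < N → a N = b N) {k : ℝ}
    (ha : Tendsto a atTop (𝓝 k)) : Tendsto b atTop (𝓝 k) := by
  refine ha.congr' ?_
  filter_upwards [eventually_gt_atTop 0] with N hN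
  exact hab N hN

/-- **The response coefficients ARE the escape-deficit sequence.** Under weak-NESS uniqueness, along any steady-state
family of `pinnedChain ω₂ lam β γ` (all `> 0`), at `T > 0`: if `D N` is the clause-(ii) response coefficient at length
`N ≥ 1` then `D N = (N-1)·γ·E_N` (`responseIdentity_proof` + uniqueness of limits along `𝓝[≠] 0`).
[cite: KunduDharNarayan2009, arXiv:0809.4543 p. 3] -/
theorem responseCoeff_eq_escapeDeficit {ω₂ lam β γ : ℝ} (hω : 0 < ω₂) (hl : 0 < lam) (hβ : 0 < β) (hγ : 0 < γ)
    (hU : ∀ (N : ℕ) (T_L T_R : ℝ), 0 < T_L → 0 < T_R → ∀ μ ν : Measure (PhaseSpace N),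
      (pinnedChain ω₂ lam β γ).IsSteadyState N T_L T_R μ →
        (pinnedChain ω₂ lam β γ).IsSteadyState N T_L T_R ν → μ = ν)
    (μ : (N : ℕ) → ℝ → ℝ → Measure (PhaseSpace N))
    (hμ : ∀ (N : ℕ) (T_L T_R : ℝ), 0 < T_L → 0 < T_R →
      (pinnedChain ω₂ lam β γ).IsSteadyState N T_L T_R (μ N T_L T_R))
    {T : ℝ} (hT : 0 < T) {N : ℕ} (hN : 0 < N) {d : ℝ}
    (hd : Tendsto (fun δ : ℝ =>
        (pinnedChain ω₂ lam β γ).totalCurrent (μ N (T + δ / 2) (T - δ / 2)) / δ) (𝓝[≠] 0) (𝓝 d)) :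
    d = ((N : ℝ) - 1) * γ * (1 - γ / T ^ 2 * ∫ u in Set.Ioi (0 : ℝ),
      ∫ z, ((z.2 ⟨0, hN⟩) ^ 2 - T) * (∫ y, ((y.2 ⟨0, hN⟩) ^ 2 - T)
        ∂((pinnedChain ω₂ lam β γ).transitionKernel N T T u.toNNReal z))
        ∂((pinnedChain ω₂ lam β γ).gibbsMeasure N T)) := by
  have h := Summit.AtomisticToContinuum.FouriersLaw.Cruxes.SuperadditiveResistance.ThermaliseThenCutProbeInsertion.responseIdentity_proof
    ω₂ lam β γ hω hl hβ hγ hU μ hμ T hT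
  dsimp only at h
  obtain ⟨-, hlim⟩ := h N hN
  simp only [dif_pos hN] at hlim
  exact tendsto_nhds_unique hd hlim

/-- **`BoundedResponseConverges` in escape-deficit form.** The crux holds iff for all parameters `> 0` and every
`T > 0` the explicit equilibrium sequence `e_N = (N-1)·γ·E_N` (`E_N = 1 - (γ/T²)∫_{(0,∞)} K_N`, `K_N` the boundary
kinetic-energy autocorrelation of the `N`-chain at equilibrium; `BoundaryEscapeDeficit`'s `let K`, `let E` verbatim)
satisfies: `(|e_N|)` bounded ⇒ `e_N → k` for some `k > 0`. [cite: KunduDharNarayan2009, arXiv:0809.4543 p. 3] -/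
theorem boundedResponseConverges_iff_escapeDeficit :
    Summit.AtomisticToContinuum.FouriersLaw.Theses.OddSectorIrreversibility.BoundedResponseConverges ↔
      ∀ ω₂ lam β γ : ℝ, 0 < ω₂ → 0 < lam → 0 < β → 0 < γ → ∀ T : ℝ, 0 < T →
        BddAbove (Set.range fun N : ℕ =>
          |((N : ℝ) - 1) * γ * (1 - γ / T ^ 2 * ∫ u in Set.Ioi (0 : ℝ), (if h : 0 < N then ∫ z, ((z.2 ⟨0, h⟩) ^ 2 - T) * (∫ y, ((y.2 ⟨0, h⟩) ^ 2 - T) ∂((Literature.MathematicalPhysics.KineticTheory.HeatConduction.pinnedChain ω₂ lam β γ).transitionKernel N T T u.toNNReal z)) ∂((Literature.MathematicalPhysics.KineticTheory.HeatConduction.pinnedChain ω₂ lam β γ).gibbsMeasure N T) else 0))|) →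
        ∃ k : ℝ, 0 < k ∧ Filter.Tendsto (fun N : ℕ =>
          ((N : ℝ) - 1) * γ * (1 - γ / T ^ 2 * ∫ u in Set.Ioi (0 : ℝ), (if h : 0 < N then ∫ z, ((z.2 ⟨0, h⟩) ^ 2 - T) * (∫ y, ((y.2 ⟨0, h⟩) ^ 2 - T) ∂((Literature.MathematicalPhysics.KineticTheory.HeatConduction.pinnedChain ω₂ lam β γ).transitionKernel N T T u.toNNReal z)) ∂((Literature.MathematicalPhysics.KineticTheory.HeatConduction.pinnedChain ω₂ lam β γ).gibbsMeasure N T) else 0))) Filter.atTop (nhds k) := by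
  constructor
  · intro hC ω₂ lam β γ hω hl hβ hγ T hT hbdd
    -- the canonical steady-state family and the crux instantiated along it
    have hU : ∀ (N : ℕ) (T_L T_R : ℝ), 0 < T_L → 0 < T_R → ∀ μ ν : Measure (PhaseSpace N),
        (pinnedChain ω₂ lam β γ).IsSteadyState N T_L T_R μ →
          (pinnedChain ω₂ lam β γ).IsSteadyState N T_L T_R ν → μ = ν :=
      nessUnique_proof ω₂ lam β γ hω hl hβ hγ
    classical
    set μc : (N : ℕ) → ℝ → ℝ → Measure (PhaseSpace N) := fun N T_L T_R =>
      if h : 0 < T_L ∧ 0 < T_R then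
        Classical.choose (pinnedChain_exists_isSteadyState hω hl hβ hγ N h.1 h.2) else 0 with hμc
    have hμc' : ∀ (N : ℕ) (T_L T_R : ℝ), 0 < T_L → 0 < T_R →
        (pinnedChain ω₂ lam β γ).IsSteadyState N T_L T_R (μc N T_L T_R) := by
      intro N T_L T_R hL hR
      have h : 0 < T_L ∧ 0 < T_R := ⟨hL, hR⟩
      simp only [hμc, dif_pos h]
      exact Classical.choose_spec (pinnedChain_exists_isSteadyState hω hl hβ hγ N h.1 h.2)
    -- the response sequence: `e_N` for `N ≥ 1`, `0` for the empty chain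
    set e : ℕ → ℝ := fun N => ((N : ℝ) - 1) * γ * (1 - γ / T ^ 2 * ∫ u in Set.Ioi (0 : ℝ),
      if h : 0 < N then ∫ z, ((z.2 ⟨0, h⟩) ^ 2 - T) * (∫ y, ((y.2 ⟨0, h⟩) ^ 2 - T)
        ∂((pinnedChain ω₂ lam β γ).transitionKernel N T T u.toNNReal z))
        ∂((pinnedChain ω₂ lam β γ).gibbsMeasure N T) else 0) with he
    set D : ℕ → ℝ := fun N => if 0 < N then e N else 0 with hDdef
    have hDe : ∀ N : ℕ, 0 < N → D N = e N := fun N hN => by simp only [hDdef, if_pos hN]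
    have hresp : ∀ N : ℕ, Tendsto (fun δ : ℝ =>
        (pinnedChain ω₂ lam β γ).totalCurrent (μc N (T + δ / 2) (T - δ / 2)) / δ) (𝓝[≠] 0) (𝓝 (D N)) := by
      intro N
      rcases Nat.eq_zero_or_pos N with rfl | hN
      · have h0 : (fun δ : ℝ => (pinnedChain ω₂ lam β γ).totalCurrent (μc 0 (T + δ / 2) (T - δ / 2)) / δ) =
            fun _ => 0 := by
          funext δ; rw [OscillatorChain.totalCurrent_zero, zero_div]
        rw [h0]
        simp only [hDdef, lt_self_iff_false, if_false]
        exact tendsto_const_nhds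
      · have h := Summit.AtomisticToContinuum.FouriersLaw.Cruxes.SuperadditiveResistance.ThermaliseThenCutProbeInsertion.responseIdentity_proof
          ω₂ lam β γ hω hl hβ hγ hU μc hμc' T hT
        dsimp only at h
        obtain ⟨-, hlim⟩ := h N hN
        rw [hDe N hN]
        exact hlim
    have hbddD : BddAbove (Set.range fun N : ℕ => |D N|) :=
      bddAbove_range_abs_of_eq_of_pos (fun N hN => (hDe N hN).symm) hbdd
    obtain ⟨k, hk, hlim⟩ := hC ω₂ lam β γ hω hl hβ hγ hU μc hμc' T hT D hresp hbddD
    exact ⟨k, hk, tendsto_of_eq_of_pos hDe hlim⟩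
  · intro h ω₂ lam β γ hω hl hβ hγ hU μ hμ T hT D hD hbdd
    have h' := h ω₂ lam β γ hω hl hβ hγ T hT
    -- `D N = e_N` for `N ≥ 1`
    have hDe : ∀ N : ℕ, 0 < N → D N = ((N : ℝ) - 1) * γ * (1 - γ / T ^ 2 * ∫ u in Set.Ioi (0 : ℝ),
        if h : 0 < N then ∫ z, ((z.2 ⟨0, h⟩) ^ 2 - T) * (∫ y, ((y.2 ⟨0, h⟩) ^ 2 - T)
          ∂((pinnedChain ω₂ lam β γ).transitionKernel N T T u.toNNReal z))
          ∂((pinnedChain ω₂ lam β γ).gibbsMeasure N T) else 0) := by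
      intro N hN
      rw [responseCoeff_eq_escapeDeficit hω hl hβ hγ hU μ hμ hT hN (hD N)]
      simp only [dif_pos hN]
    have hbdd' := bddAbove_range_abs_of_eq_of_pos hDe hbdd
    obtain ⟨k, hk, hlim⟩ := h' hbdd'
    exact ⟨k, hk, tendsto_of_eq_of_pos (fun N hN => (hDe N hN).symm) hlim⟩

/-- **`EscapeLaw ⟹ BoundedResponseConverges`**: the target of route `BoundaryEscapeDeficit`
(stmt-AtomisticToContinuum-12234: `(N-1)·γ·E_N → κ_b > 0`) closes this crux by name — every response coefficient is
`(N-1)·γ·E_N` (`responseCoeff_eq_escapeDeficit`), so `D_N → κ_b`; the crux's boundedness hypothesis is idle here.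
[cite: KunduDharNarayan2009, arXiv:0809.4543 p. 3] -/
theorem boundedResponseConverges_of_escapeLaw :
    Summit.AtomisticToContinuum.FouriersLaw.Theses.BoundaryEscapeDeficit.EscapeLaw →
      Summit.AtomisticToContinuum.FouriersLaw.Theses.OddSectorIrreversibility.BoundedResponseConverges := by
  intro hE ω₂ lam β γ hω hl hβ hγ hU μ hμ T hT D hD _hbdd
  have h := hE ω₂ lam β γ hω hl hβ hγ T hT
  dsimp only at h
  obtain ⟨κb, hκb, hlim⟩ := h
  refine ⟨κb, hκb, tendsto_of_eq_of_pos (fun N hN => ?_) hlim⟩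
  rw [responseCoeff_eq_escapeDeficit hω hl hβ hγ hU μ hμ hT hN (hD N)]
  simp only [dif_pos hN]

/-- **The equilibrium ladder closes the crux.** If for all parameters `> 0` and `T > 0` the escape-deficit sequence
`e_N = (N-1)·γ·E_N` is eventually non-decreasing — `(N-1)·E_N ≤ N·E_{N+1}` for `N ≥ N₀`, the auto-kernel form of the
ladder `D_N ≤ D_{N+1}` of line `ohmic-floor-monotone-ladder` — then `BoundedResponseConverges`: along any family the
response coefficients are `e_N` (`N ≥ 1`), bounded by hypothesis, positive for `N ≥ 2` (`positiveConductance_holds`),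
and an eventually non-decreasing bounded sequence positive somewhere converges to a positive limit
(`boundedResponseConverges_ladder_matrix_iff`). [folklore] -/
theorem boundedResponseConverges_of_escapeLadder :
    (∀ ω₂ lam β γ : ℝ, 0 < ω₂ → 0 < lam → 0 < β → 0 < γ → ∀ T : ℝ, 0 < T →
      ∃ N₀ : ℕ, ∀ N : ℕ, N₀ ≤ N →
        ((N : ℝ) - 1) * (1 - γ / T ^ 2 * ∫ u in Set.Ioi (0 : ℝ), (if h : 0 < N then ∫ z, ((z.2 ⟨0, h⟩) ^ 2 - T) * (∫ y, ((y.2 ⟨0, h⟩) ^ 2 - T) ∂((Literature.MathematicalPhysics.KineticTheory.HeatConduction.pinnedChain ω₂ lam β γ).transitionKernel N T T u.toNNReal z)) ∂((Literature.MathematicalPhysics.KineticTheory.HeatConduction.pinnedChain ω₂ lam β γ).gibbsMeasure N T) else 0)) ≤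
          (N : ℝ) * (1 - γ / T ^ 2 * ∫ u in Set.Ioi (0 : ℝ), (if h : 0 < N + 1 then ∫ z, ((z.2 ⟨0, h⟩) ^ 2 - T) * (∫ y, ((y.2 ⟨0, h⟩) ^ 2 - T) ∂((Literature.MathematicalPhysics.KineticTheory.HeatConduction.pinnedChain ω₂ lam β γ).transitionKernel (N + 1) T T u.toNNReal z)) ∂((Literature.MathematicalPhysics.KineticTheory.HeatConduction.pinnedChain ω₂ lam β γ).gibbsMeasure (N + 1) T) else 0))) →
    Summit.AtomisticToContinuum.FouriersLaw.Theses.OddSectorIrreversibility.BoundedResponseConverges := by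
  intro hL ω₂ lam β γ hω hl hβ hγ hU μ hμ T hT D hD hbdd
  obtain ⟨N₀, hN₀⟩ := hL ω₂ lam β γ hω hl hβ hγ T hT
  -- `D N = e_N` for `N ≥ 1`
  have hDe : ∀ N : ℕ, (hN : 0 < N) → D N = ((N : ℝ) - 1) * γ * (1 - γ / T ^ 2 * ∫ u in Set.Ioi (0 : ℝ),
      ∫ z, ((z.2 ⟨0, hN⟩) ^ 2 - T) * (∫ y, ((y.2 ⟨0, hN⟩) ^ 2 - T)
        ∂((pinnedChain ω₂ lam β γ).transitionKernel N T T u.toNNReal z))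
        ∂((pinnedChain ω₂ lam β γ).gibbsMeasure N T)) := fun N hN =>
    responseCoeff_eq_escapeDeficit hω hl hβ hγ hU μ hμ hT hN (hD N)
  -- the ladder in `D`-form beyond `max N₀ 1`
  have hmono : ∀ N : ℕ, max N₀ 1 ≤ N → D N ≤ D (N + 1) := by
    intro N hN
    have hN0 : 0 < N := lt_of_lt_of_le Nat.one_pos ((le_max_right _ _).trans hN)
    have hN1 : 0 < N + 1 := Nat.succ_pos _
    have hstep := hN₀ N ((le_max_left _ _).trans hN)
    simp only [dif_pos hN0, dif_pos hN1] at hstep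
    rw [hDe N hN0, hDe (N + 1) hN1]
    push_cast
    have e1 : ∀ X : ℝ, ((N : ℝ) - 1) * γ * X = γ * (((N : ℝ) - 1) * X) := fun X => by ring
    have e2 : ∀ X : ℝ, ((N : ℝ) + 1 - 1) * γ * X = γ * ((N : ℝ) * X) := fun X => by ring
    rw [e1, e2]
    exact mul_le_mul_of_nonneg_left hstep hγ.le
  -- positivity somewhere beyond the threshold: `D_N > 0` for `N ≥ 2`
  have hP := Summit.AtomisticToContinuum.FouriersLaw.Cruxes.BoundedResponseConverges.TwoScaleGluingLogRigidity.Stubs.stub_positiveConductance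
    ω₂ lam β γ hω hl hβ hγ hU μ hμ T hT D hD
  have hpos : ∃ N : ℕ, max N₀ 1 ≤ N ∧ 0 < D N :=
    ⟨max N₀ 1 + 2, Nat.le_add_right _ _, hP _ (Nat.le_add_left _ _)⟩
  exact (boundedResponseConverges_ladder_matrix_iff hmono hbdd).2 hpos

end Summit.AtomisticToContinuum.FouriersLaw.Theorems

end
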